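import Summits.Ventures.PackingBounds.ThreePointCert.Soundness
import Summits.Ventures.PackingBounds.ThreePointCert.C9TExpandR0p1
import Summits.Ventures.PackingBounds.ThreePointCert.C9TExpandR0p2
import Summits.Ventures.PackingBounds.ThreePointCert.C9TExpandR1p1
import Summits.Ventures.PackingBounds.ThreePointCert.C9TExpandR2p1
import Summits.Ventures.PackingBounds.ThreePointCert.C9TExpandR3p1
import Summits.Ventures.PackingBounds.ThreePointCert.C9TExpandR4p1
import Summits.Ventures.PackingBounds.ThreePointCert.C9TExpandQF

/-!
# A(9, arccos 1/3) ≤ 99 (three-point bound, kernel-checked): the kernel-checked theorem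

Framing: lottery ticket; floor = certified bounds/negative ranges. Venture `PackingBounds` (cell
`pub-packcert`), three-point SDP family. Integer data of a feasible point of the Bachoc–Vallentin
semidefinite program (n = 9, s = 1/3, degree d = 8, symmetric
sums of squares), derived by `pub-packcert-sdp/code/cert2lean.py` from the exact rational
certificate `sdp-n9-d8-s1-3-sym.json` of the cell (two independent exact verifiers + referee), in the
units of the kernel checker `ThreePointCert.Check` (soundness `ThreePointCert.Sound`). Generated
file: plain lists of integers / monomials.
-/

namespace Summit.Ventures.PackingBounds.ThreePointCert.C9T

open Literature.Geometry.DiscreteGeometry Literature.Geometry.DiscreteGeometry.PolyCert PolyCert.SPoly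

set_option maxRecDepth 100000 in
/-- All expansion data are valid (assembled from the kernel validations). -/
theorem polys_ok : PolysOK3 C9T.cert C9T.polys C9T.gR0 C9T.gR1 C9T.gR2 C9T.gR3 C9T.gR4 C9T.gQ0 C9T.gQ1 where
  hF := fexpValidG_of_fchunkVal cert eFP _ (by rfl) (fchunkVal_append _ _ _ _ _ _ (fchunkVal_append _ _ _ _ _ _ (fchunkVal_append _ _ _ _ _ _ (fchunkVal_append _ _ _ _ _ _ (fchunkVal_append _ _ _ _ _ _ (fchunkVal_of_ok _ _ _ _ okF_1) (fchunkVal_of_ok _ _ _ _ okF_2)) (fchunkVal_of_ok _ _ _ _ okF_3)) (fchunkVal_of_ok _ _ _ _ okF_4)) (fchunkVal_of_ok _ _ _ _ okF_5)) (fchunkVal_of_ok _ _ _ _ okF_6))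
  h0 := by
    have c := chunkVal_of_ok _ _ _ _ _ okR0_1
    have c := chunkVal_trans _ _ _ _ _ _ _ c (chunkVal_of_ok _ _ _ _ _ okR0_2)
    have c := chunkVal_trans _ _ _ _ _ _ _ c (chunkVal_of_ok _ _ _ _ _ okR0_3)
    have c := chunkVal_trans _ _ _ _ _ _ _ c (chunkVal_of_ok _ _ _ _ _ okR0_4)
    have c := chunkVal_trans _ _ _ _ _ _ _ c (chunkVal_of_ok _ _ _ _ _ okR0_5)
    have c := chunkVal_trans _ _ _ _ _ _ _ c (chunkVal_of_ok _ _ _ _ _ okR0_6)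
    have c := chunkVal_trans _ _ _ _ _ _ _ c (chunkVal_of_ok _ _ _ _ _ okR0_7)
    have c := chunkVal_trans _ _ _ _ _ _ _ c (chunkVal_of_ok _ _ _ _ _ okR0_8)
    exact c
  h1 := by
    have c := chunkVal_of_ok _ _ _ _ _ okR1_1
    have c := chunkVal_trans _ _ _ _ _ _ _ c (chunkVal_of_ok _ _ _ _ _ okR1_2)
    have c := chunkVal_trans _ _ _ _ _ _ _ c (chunkVal_of_ok _ _ _ _ _ okR1_3)
    exact c
  h2 := by
    have c := chunkVal_of_ok _ _ _ _ _ okR2_1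
    have c := chunkVal_trans _ _ _ _ _ _ _ c (chunkVal_of_ok _ _ _ _ _ okR2_2)
    exact c
  h3 := rvalid_of_single gR3 eR3 okR3_1
  h4 := by
    have c := chunkVal_of_ok _ _ _ _ _ okR4_1
    have c := chunkVal_trans _ _ _ _ _ _ _ c (chunkVal_of_ok _ _ _ _ _ okR4_2)
    exact c
  hq0 := rvalid_of_single gQ0 eQ0 okQ0_1
  hq1 := rvalid_of_single gQ1 eQ1 okQ1_1

set_option maxHeartbeats 0 in
/-- The side conditions hold. -/
theorem cert_side : checkSide3 C9T.cert = true := by decide +kernel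

set_option maxHeartbeats 0 in
/-- The numerical bound is `< N + 1` (and `≥ 0`). -/
theorem cert_bound : checkBound3 C9T.cert C9T.polys = true := by decide +kernel

set_option maxHeartbeats 0 in
/-- The certificate passes the check of constraint `(i')`. -/
theorem cert_I : checkI3 C9T.cert C9T.polys = true := by decide +kernel

set_option maxHeartbeats 0 in
/-- The certificate passes the check of constraint `(ii')`. -/
theorem cert_II : checkII3 C9T.cert C9T.polys = true := by decide +kernel

/-- **A(9, arccos 1/3) ≤ 99 (three-point bound, kernel-checked)**: every finite set of unit vectors of `ℝ^9` with pairwise inner products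
`≤ 1 / 3` has at most `99` elements — the Bachoc–Vallentin three-point (semidefinite
programming) bound, degree 8, from an exact certificate (bound value 99.835614), kernel-checked.
[cite: BachocVallentin2007, Theorem 4.2] -/
theorem code_dim9_third_le_99_sdp (C : Finset (EuclideanSpace ℝ (Fin 9)))
    (h1 : ∀ x ∈ C, ‖x‖ = 1) (h2 : ∀ x ∈ C, ∀ y ∈ C, x ≠ y → inner ℝ x y ≤ 1 / 3) :
    C.card ≤ 99 :=
  card_le_of_cert3 cert polys polys_ok cert_I cert_II cert_side cert_bound C h1
    (fun x hx y hy hxy => by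
      have h := h2 x hx y hy hxy
      have e : ((cert.p : ℤ) : ℝ) / (cert.q : ℕ) = 1 / 3 := by norm_num [cert]
      rw [e]; exact h)

end Summit.Ventures.PackingBounds.ThreePointCert.C9T
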